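import Mathlib.Analysis.Calculus.Deriv.MeanValue
import Mathlib.Analysis.Calculus.Deriv.Shift
import Mathlib.Analysis.Calculus.Deriv.Inv
import Mathlib.Analysis.SpecialFunctions.Pow.Deriv
import Mathlib.Analysis.SpecialFunctions.Pow.Asymptotics
import Mathlib.Topology.Order.LeftRightNhds
import Literature.Probability.LatticeModels.LatticeGreenFunction
import Literature.Barriers.CriticalPhenomena.WeaklySAWFourDimLogCorrections
import HarnessLib

/-!
# `WeaklySAWFourDimLogCorrections` (BBS 2015, Theorem 1.1): proof architecture and the proved
# top layer (§4.2–§4.3 of the source)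

Companion to `Literature/Barriers/CriticalPhenomena/WeaklySAWFourDimLogCorrections.lean`, whose
barrier `WeaklySAWFourDimLogCorrections` is literally `CTWSAW.BBS2015_thm11` (Bauerschmidt–Brydges–
Slade, CMP 337 (2015), arXiv:1403.7422, Theorem 1.1). This file concerns `BBS2015_thm11` only.

## Size of a full discharge (triage: XL)

Theorem 1.1 is the output of the Bauerschmidt–Brydges–Slade rigorous renormalisation group. The
printed proof runs: §2, Lemma 2.1 (torus approximation `χ_N ↑ χ`, analyticity of `χ` on
`Re ν > ν_c`); §3, Proposition 3.1 (the supersymmetric integral representation of the two-point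
function, [BIS09]) and the Gaussian super-expectation; §4.1, the renormalised parameters
`g = g₀/(1+z₀)²`, `ν = (ν₀+m²)/(1+z₀)`, `χ̂_N = Σ_x 𝔼_C(e^{-V₀(Λ)} φ̄₀φ_x)`, `χ_N = (1+z₀)χ̂_N`,
`χ = (1+z₀)χ̂`, `∂χ/∂ν = (1+z₀)²∂χ̂/∂ν₀`, and **Theorem 4.1** (the critical `ν₀ᶜ, z₀ᶜ`:
`χ̂ = 1/m²`, `∂χ̂/∂ν₀ ∼ -m⁻⁴c(ĝ₀)/(ĝ₀𝖡_{m²})^γ`, `γ = ¼`), "whose proof occupies the remainder of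
the paper": §5 progressive integration (Proposition 5.1), §6 the renormalisation group map
(Proposition 6.1 perturbative flow [BBS-rg-pt]; Theorem 6.4.1 = the main theorem of [BS-rg-step],
"the deepest ingredient in our analysis", resting on [BS-rg-norm], [BS-rg-loc], [BS-rg-IE];
Theorem 6.5.1, Corollary 6.6.1), §7 the global flow (Proposition 7.1.1 from Theorem 7.2.1 = the
main result of [BBS-rg-flow], Corollary 7.2.2), §8 (Propositions 8.1.1, 8.2.2, Lemmas 8.3.1–8.3.3:
`Σβ_j = 𝖡_{m²}`, `ǧ_∞ ∼ 1/𝖡_{m²}`, `μ̌'_j = L^{2j}(ǧ_j/g₀)^γ(c + O(χ_jǧ_j))`, and §8.4, the proof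
of Theorem 4.1 from `χ̂_N = m⁻² + m⁻⁴(-ν_N + |Λ|⁻¹D²W_N⁰ + |Λ|⁻¹D²K_N⁰)`). Everything from §5 on is
phrased in Banach spaces of polymer activities over Grassmann–Gaussian super-expectations; a
discharge of Theorem 4.1 is the formalisation of that theory and is not attempted here.

What IS elementary is the top layer, §4.2–§4.3: **Proposition 4.2** (change of parameters,
"involves only elementary calculus"), **Lemma 4.3** (an ODE lemma) and the "Proof of Theorem 1.1"
paragraph, which consume Theorem 4.1, the free-bubble asymptotics (1.8) and the differentiability
of `χ` in `ν` (Lemma 2.1).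

## What this file does

* `CTWSAW.chiHat` — `χ̂(m², g₀, ν₀, z₀)`, DEFINED by the identity `χ(g,ν) = (1+z₀)χ̂` at
  `g = g₀/(1+z₀)²`, `ν = (ν₀+m²)/(1+z₀)` (§4.1, the display `χ(g,ν) = (1+z₀)χ̂(m²,g₀,ν₀,z₀)`; in the source
  `χ̂` is first defined through the supersymmetric representation and this identity is then
  derived from Proposition 3.1 and Lemma 2.1, so the two definitions agree wherever the source
  uses `χ̂`); `CTWSAW.freeBubble` — the free bubble diagram `𝖡_{m²} = 8B_{m²}` of (1.8).
* Named facts (not proved): `BBS2015_eq18` ((1.8) at `d = 4`), `BBS2015_lem21` (the part of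
  Lemma 2.1 used in §4: `χ(g,·)` finite and differentiable on `(ν_c, ∞)`), `BBS2015_thm41`
  (Theorem 4.1, through the predicate `Thm41Data` listing its conclusions), `BBS2015_prop42ii`
  (Proposition 4.2(ii), relative to any data satisfying Theorem 4.1's conclusions, in the
  pointwise-in-`g` form that §4.3 consumes).
* PROVED: `BBS2015_lem43` (Lemma 4.3, for every exponent `γ > 0`; the source has `γ = ¼`), and
  `BBS2015_thm11_of_thm41` — Theorem 1.1 (hence the barrier, `weaklySAWFourDimLogCorrections_of_thm41`)
  from the four named facts, i.e. the source's "Proof of Theorem 1.1" (§4.3) including the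
  bookkeeping `A_g = (g̃₀(0)𝖻)^γ/c₀(g) = (𝖻g)^γ(1 + O(g))` with explicit constants.

Numbering: theorems/lemmas/propositions as in the arXiv and CMP versions (Lemma 2.1, Theorem 4.1,
Proposition 4.2, Lemma 4.3); displays inside §4 are located by theorem and order (their numbers
are not legible in the held text); (1.8)–(1.10) by number.
-/

noncomputable section

open MeasureTheory Filter Topology Set
open Literature.Probability.LatticeModels
open scoped ENNReal BigOperators

namespace Literature.Barriers.CriticalPhenomena

namespace CTWSAW

/-! ### Objects of §1.2 and §4.1 -/

/-- The **free bubble diagram** `𝖡_{m²} = 8B_{m²} = 8∫_{[-π,π]^d} |1/(4Σⱼ sin²(kⱼ/2) + m²)|² dk/(2π)^d`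
of simple random walk (`B_{m²} = Σ_x C_{m²}(x)²` by Parseval).
[cite: BauerschmidtBrydgesSlade2015LogCorr, eq. (1.8)] -/
def freeBubble (d : ℕ) (m2 : ℝ) : ℝ :=
  8 * ((∫ k in brillouin d, |1 / (4 * ∑ j, Real.sin (k j / 2) ^ 2 + m2)| ^ 2) / (2 * Real.pi) ^ d)

/-- The symbol `4Σⱼ sin²(kⱼ/2)` of `-Δ` in (1.8) is `2ε(k)`, `ε` the tree's `dispersion`
(`Σⱼ(1 - cos kⱼ)`). [cite: BauerschmidtBrydgesSlade2015LogCorr, eq. (1.8)] -/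
theorem four_mul_sum_sin_sq_half {d : ℕ} (k : Fin d → ℝ) :
    4 * ∑ j, Real.sin (k j / 2) ^ 2 = 2 * dispersion k := by
  simp only [dispersion, Finset.mul_sum]
  refine Finset.sum_congr rfl fun j _ => ?_
  rw [Real.sin_sq_eq_half_sub]
  ring_nf

/-- The **renormalised-parameter susceptibility** `χ̂(m², g₀, ν₀, z₀)` of §4.1, here DEFINED by
the printed identity `χ(g, ν) = (1 + z₀) χ̂(m², g₀, ν₀, z₀)` for `g = g₀/(1+z₀)²`,
`ν = (ν₀ + m²)/(1+z₀)` (the relations between bare and renormalised parameters, §4.1, the two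
displays after `V_{g,ν,1;x}(φ',ψ') = V_{0,m²,1;x} + V_{g₀,ν₀,z₀;x}`), i.e.
`χ̂ = χ(g₀/(1+z₀)², (ν₀+m²)/(1+z₀)) / (1+z₀)` as a real number (`toReal`, junk value `0` where
`χ = ∞`). In the source `χ̂_N(m²,g₀,ν₀,z₀) = Σ_{x∈Λ} 𝔼_C(e^{-V₀(Λ)}φ̄₀φ_x)` is a Gaussian
super-expectation, `χ̂ = lim_N χ̂_N`, and the identity is DERIVED (from Proposition 3.1 and
Lemma 2.1); the two agree for `z₀ > -1`, `g₀ > 0`, which is where the source uses `χ̂`.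
[cite: BauerschmidtBrydgesSlade2015LogCorr, §4.1 (the display χ(g,ν) = (1+z₀)χ̂(m²,g₀,ν₀,z₀))] -/
def chiHat (d : ℕ) (m2 g₀ ν₀ z₀ : ℝ) : ℝ :=
  (susceptibility d (g₀ / (1 + z₀) ^ 2) ((ν₀ + m2) / (1 + z₀))).toReal / (1 + z₀)

/-- With `z₀ = 0` the renormalised parameters are the bare ones shifted by the mass:
`χ̂(m², g₀, ν₀, 0) = χ(g₀, ν₀ + m²)` (the relations `g = g₀/(1+z₀)²`, `ν = (ν₀+m²)/(1+z₀)` at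
`z₀ = 0`). [cite: BauerschmidtBrydgesSlade2015LogCorr, §4.1 (renormalised parameters, z₀ = 0)] -/
theorem chiHat_zero_right (d : ℕ) (m2 g₀ ν₀ : ℝ) :
    chiHat d m2 g₀ ν₀ 0 = (susceptibility d g₀ (ν₀ + m2)).toReal := by
  simp [chiHat]

/-- (1.8) rewritten with the tree's dispersion `ε(k) = Σⱼ(1 - cos kⱼ)`:
`𝖡_{m²} = 8∫_{[-π,π]^d} |1/(2ε(k) + m²)|² dk/(2π)^d`. [cite: BauerschmidtBrydgesSlade2015LogCorr, eq. (1.8)] -/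
theorem freeBubble_eq_dispersion (d : ℕ) (m2 : ℝ) :
    freeBubble d m2 =
      8 * ((∫ k in brillouin d, |1 / (2 * dispersion k + m2)| ^ 2) / (2 * Real.pi) ^ d) := by
  simp_rw [freeBubble, four_mul_sum_sin_sq_half]

/-! ### Named facts: (1.8), Lemma 2.1, Theorem 4.1, Proposition 4.2(ii) -/

/-- **(1.8) at `d = 4`**: "as `m² ↓ 0`, `𝖡_{m²} ∼ 𝖻 log m⁻²`" with `𝖻 = 1/(2π²)` (= `freeBubbleB`),
"by Parseval's formula and elementary calculus". (`∼`: ratio `→ 1`; `m⁻² = (m²)⁻¹`.)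
[cite: BauerschmidtBrydgesSlade2015LogCorr, eq. (1.8)] -/
def BBS2015_eq18 : Prop :=
  Tendsto (fun m2 : ℝ => freeBubble 4 m2 / (freeBubbleB * Real.log m2⁻¹)) (𝓝[>] 0) (𝓝 1)

/-- The part of **Lemma 2.1** used in §4 ("The functions `χ_N` and `χ` are analytic on
`{ν ∈ ℂ : Re ν > ν_c}`", with "`χ(ν) = ∞` for `ν ≤ ν_c`"), in the weaker real form: for every
`d > 0`, `g > 0` and `ν > ν_c(d,g)`, `χ(g,ν) < ∞` and `ν ↦ χ(g,ν)` is differentiable at `ν`.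
[cite: BauerschmidtBrydgesSlade2015LogCorr, Lemma 2.1] -/
def BBS2015_lem21 : Prop :=
  ∀ d : ℕ, 0 < d → ∀ g : ℝ, 0 < g → ∀ ν : ℝ, criticalNu d g < ν →
    susceptibility d g ν < ∞ ∧
      DifferentiableAt ℝ (fun ν' : ℝ => (susceptibility d g ν').toReal) ν

/-- The conclusions of **Theorem 4.1** (`d = 4`) for given data: `δ > 0`, the critical functions
`ν₀ᶜ, z₀ᶜ : [0,δ)² → ℝ` (curried, `ν₀c m² g₀`), the function `c` and a constant `K` for the
printed `O(·)`'s. Transcribed: "continuous real-valued functions `ν₀ᶜ, z₀ᶜ` defined for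
`(m², g₀) ∈ [0,δ)²` and [continuously] differentiable in `g₀`" (differentiability on `(0,δ)` as
in Proposition 7.1.1; continuity of the `g₀`-derivative is not transcribed), "a continuous
function `c(g₀) = 1 + O(g₀)`" (read on `(0,δ)`, where the displays use it: continuous there and
`|c(g₀) - 1| ≤ Kg₀`), and "for all `m², g₀, ĝ₀ ∈ (0,δ)`": `χ̂(m², g₀, ν₀ᶜ, z₀ᶜ) = 1/m²`
(first display) and `∂χ̂/∂ν₀(m², g₀, ν₀ᶜ, z₀ᶜ) ∼ -m⁻⁴ c(ĝ₀)/(ĝ₀𝖡_{m²})^γ` as `(m²,g₀) → (0,ĝ₀)`,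
`γ = ¼` (second display; `∼` = ratio `→ 1`, the limit taken within `(0,δ)²`); and (third display):
`ν₀ᶜ(m²,0) = z₀ᶜ(m²,0) = 0`, `∂ν₀ᶜ/∂g₀, ∂z₀ᶜ/∂g₀ = O(1)` "bounded on their whole domain by
constants uniform in `(m², g₀)`". [cite: BauerschmidtBrydgesSlade2015LogCorr, Theorem 4.1] -/
structure Thm41Data (δ K : ℝ) (ν₀c z₀c : ℝ → ℝ → ℝ) (c : ℝ → ℝ) : Prop where
  /-- `δ > 0`. -/
  pos : 0 < δ
  /-- `ν₀ᶜ` is continuous on `[0,δ)²`. -/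
  cont_ν₀c : ContinuousOn (fun p : ℝ × ℝ => ν₀c p.1 p.2) (Ico 0 δ ×ˢ Ico 0 δ)
  /-- `z₀ᶜ` is continuous on `[0,δ)²`. -/
  cont_z₀c : ContinuousOn (fun p : ℝ × ℝ => z₀c p.1 p.2) (Ico 0 δ ×ˢ Ico 0 δ)
  /-- `ν₀ᶜ(m², ·)` is differentiable in `g₀ ∈ (0,δ)`. -/
  diff_ν₀c : ∀ m2 ∈ Ico (0:ℝ) δ, DifferentiableOn ℝ (ν₀c m2) (Ioo 0 δ)
  /-- `z₀ᶜ(m², ·)` is differentiable in `g₀ ∈ (0,δ)`. -/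
  diff_z₀c : ∀ m2 ∈ Ico (0:ℝ) δ, DifferentiableOn ℝ (z₀c m2) (Ioo 0 δ)
  /-- `c` is continuous (on `(0,δ)`, where the displays use it). -/
  cont_c : ContinuousOn c (Ioo 0 δ)
  /-- `c(g₀) = 1 + O(g₀)` on `(0,δ)`. -/
  c_sub_one : ∀ g₀ ∈ Ioo (0:ℝ) δ, |c g₀ - 1| ≤ K * g₀
  /-- First display: `χ̂(m², g₀, ν₀ᶜ(m²,g₀), z₀ᶜ(m²,g₀)) = 1/m²` for `m², g₀ ∈ (0,δ)`. -/
  chiHat_eq : ∀ m2 ∈ Ioo (0:ℝ) δ, ∀ g₀ ∈ Ioo (0:ℝ) δ,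
    chiHat 4 m2 g₀ (ν₀c m2 g₀) (z₀c m2 g₀) = 1 / m2
  /-- Second display: `∂χ̂/∂ν₀(m², g₀, ν₀ᶜ, z₀ᶜ) / (-m⁻⁴ c(ĝ₀) (ĝ₀𝖡_{m²})^{-1/4}) → 1` as
  `(m², g₀) → (0, ĝ₀)` within `(0,δ)²`, for every `ĝ₀ ∈ (0,δ)`. -/
  chiHat_deriv : ∀ ĝ₀ ∈ Ioo (0:ℝ) δ,
    Tendsto (fun p : ℝ × ℝ =>
        deriv (fun ν₀ => chiHat 4 p.1 p.2 ν₀ (z₀c p.1 p.2)) (ν₀c p.1 p.2) /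
          (-(1 / p.1 ^ 2) * c ĝ₀ / (ĝ₀ * freeBubble 4 p.1) ^ (1 / 4 : ℝ)))
      (𝓝[Ioo 0 δ ×ˢ Ioo 0 δ] (0, ĝ₀)) (𝓝 1)
  /-- Third display: `ν₀ᶜ(m², 0) = 0`. -/
  ν₀c_zero : ∀ m2 ∈ Ico (0:ℝ) δ, ν₀c m2 0 = 0
  /-- Third display: `z₀ᶜ(m², 0) = 0`. -/
  z₀c_zero : ∀ m2 ∈ Ico (0:ℝ) δ, z₀c m2 0 = 0
  /-- Third display: `∂ν₀ᶜ/∂g₀ = O(1)` uniformly. -/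
  deriv_ν₀c : ∀ m2 ∈ Ico (0:ℝ) δ, ∀ g₀ ∈ Ioo (0:ℝ) δ, |deriv (ν₀c m2) g₀| ≤ K
  /-- Third display: `∂z₀ᶜ/∂g₀ = O(1)` uniformly. -/
  deriv_z₀c : ∀ m2 ∈ Ico (0:ℝ) δ, ∀ g₀ ∈ Ioo (0:ℝ) δ, |deriv (z₀c m2) g₀| ≤ K

/-- **Theorem 4.1** of Bauerschmidt–Brydges–Slade 2015 ("Let `d = 4`, and let `δ > 0` be
sufficiently small. There are continuous real-valued functions `ν₀ᶜ, z₀ᶜ`, defined for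
`(m², g₀) ∈ [0,δ)²` and continuously differentiable in `g₀`, and there is a continuous function
`c(g₀) = 1 + O(g₀)`, such that for all `m², g₀, ĝ₀ ∈ (0,δ)`,
`χ̂(m², g₀, ν₀ᶜ(m²,g₀), z₀ᶜ(m²,g₀)) = 1/m²`,
`∂χ̂/∂ν₀(m², g₀, ν₀ᶜ(m²,g₀), z₀ᶜ(m²,g₀)) ∼ -(1/m⁴) c(ĝ₀)/(ĝ₀𝖡_{m²})^γ` as `(m²,g₀) → (0,ĝ₀)`.
The functions `ν₀ᶜ, z₀ᶜ` obey `ν₀ᶜ(m²,0) = z₀ᶜ(m²,0) = 0`, `∂ν₀ᶜ/∂g₀ = O(1)`,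
`∂z₀ᶜ/∂g₀ = O(1)`"), `γ = ¼`, with `χ̂` read through `chiHat` (see there) — the output of the
renormalisation-group analysis of §5–§8 and of the companion papers; NOT proved here.
[cite: BauerschmidtBrydgesSlade2015LogCorr, Theorem 4.1] -/
def BBS2015_thm41 : Prop :=
  ∃ (δ K : ℝ) (ν₀c z₀c : ℝ → ℝ → ℝ) (c : ℝ → ℝ), Thm41Data δ K ν₀c z₀c c

/-- **Proposition 4.2(ii)** of Bauerschmidt–Brydges–Slade 2015, relative to any functions
`ν₀ᶜ, z₀ᶜ` with the properties listed in Theorem 4.1 (which is how it is proved in print, by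
"elementary calculus" from Theorem 4.1, the identity `χ = (1+z₀)χ̂` and `χ ↑ ∞` at `ν_c`): for
small `g > 0` there are `m̃²(g,ε), g̃₀(g,ε)` (and `ν̃₀ = ν₀ᶜ(m̃², g̃₀)`, `z̃₀ = z₀ᶜ(m̃², g̃₀)`, i.e.
the constraint `ν₀ = ν₀ᶜ(m²,g₀), z₀ = z₀ᶜ(m²,g₀)` of §4.2 holds, which includes
`(m̃², g̃₀) ∈ [0,δ)²`), right-continuous as `ε ↓ 0`, with
`m̃²(g,0) = 0`, `m̃²(g,ε) > 0` for `ε > 0`, `g̃₀ = g + O(g²)`, `ν̃₀ = O(g)`, `z̃₀ = O(g)`, such that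
the bare/renormalised relations of §4.1 hold at `(g, ν_c(g) + ε)`: `g = g̃₀/(1+z̃₀)²`,
`ν_c(g) + ε = (ν̃₀ + m̃²)/(1+z̃₀)`. Printed for `(g,ε) ∈ [0,δ₁)²`; vendored in the (weaker)
pointwise-in-`g` form — an `ε`-range `[0, ε₁(g))` for each `g ∈ (0,δ₁)` — which is what the proof
of Theorem 1.1 (§4.3: `g` fixed, `ε ↓ 0`) consumes, the `O(·)` constants being uniform in `g`.
Below `mt = m̃²(g,·)`, `gt = g̃₀(g,·)`; the relations are quantified over `ε ∈ [0, ε₁)`, and at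
`ε = 0` (where `m̃² = 0`) the second one reads `ν_c(g) = ν₀ᶜ(0, g̃₀(g,0))/(1 + z₀ᶜ(0, g̃₀(g,0)))`,
i.e. `ν_c(g) = ν*(0,g)` (proof of Proposition 4.2(i); also the first display of §8.5).
[cite: BauerschmidtBrydgesSlade2015LogCorr, Proposition 4.2(ii)] -/
def BBS2015_prop42ii : Prop :=
  ∀ (δ K : ℝ) (ν₀c z₀c : ℝ → ℝ → ℝ) (c : ℝ → ℝ), Thm41Data δ K ν₀c z₀c c →
    ∃ δ₁ K₁ : ℝ, 0 < δ₁ ∧ ∀ g ∈ Ioo (0:ℝ) δ₁, ∃ ε₁ : ℝ, 0 < ε₁ ∧ ∃ mt gt : ℝ → ℝ,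
      mt 0 = 0 ∧ ContinuousWithinAt mt (Ici 0) 0 ∧ ContinuousWithinAt gt (Ici 0) 0 ∧
      (∀ ε ∈ Ioo (0:ℝ) ε₁, 0 < mt ε) ∧
      ∀ ε ∈ Ico (0:ℝ) ε₁, mt ε < δ ∧ gt ε ∈ Ioo (0:ℝ) δ ∧ |gt ε - g| ≤ K₁ * g ^ 2 ∧
        |ν₀c (mt ε) (gt ε)| ≤ K₁ * g ∧ |z₀c (mt ε) (gt ε)| ≤ K₁ * g ∧
        g = gt ε / (1 + z₀c (mt ε) (gt ε)) ^ 2 ∧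
        criticalNu 4 g + ε = (ν₀c (mt ε) (gt ε) + mt ε) / (1 + z₀c (mt ε) (gt ε))

/-! ### Lemma 4.3 (proved) -/

/-- `x (-log x)^γ → 0` as `x ↓ 0`, for `γ > 0` (used in the proof of Lemma 4.3: the function
`f(x) = x(-log x)^γ` extends continuously by `0`). [folklore] -/
theorem tendsto_mul_neg_log_rpow_nhdsGT_zero {γ : ℝ} (hγ : 0 < γ) :
    Tendsto (fun x : ℝ => x * (-Real.log x) ^ γ) (𝓝[>] 0) (𝓝 0) := by
  have h1 : Tendsto (fun x : ℝ => -(Real.log x * x ^ (1 / γ))) (𝓝[>] 0) (𝓝 0) := by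
    simpa using (tendsto_log_mul_rpow_nhdsGT_zero (one_div_pos.2 hγ)).neg
  have h2 : Tendsto (fun x : ℝ => (-(Real.log x * x ^ (1 / γ))) ^ γ) (𝓝[>] 0) (𝓝 0) := by
    have hc : ContinuousAt (fun t : ℝ => t ^ γ) 0 :=
      Real.continuousAt_rpow_const 0 γ (Or.inr hγ.le)
    have h := hc.tendsto.comp h1
    simpa [Function.comp_def, Real.zero_rpow hγ.ne'] using h
  refine h2.congr' ?_
  filter_upwards [Ioo_mem_nhdsGT (zero_lt_one' ℝ)] with x hx
  have hlog : 0 ≤ -Real.log x := by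
    rw [neg_nonneg]; exact Real.log_nonpos hx.1.le hx.2.le
  rw [show -(Real.log x * x ^ (1 / γ)) = (-Real.log x) * x ^ (1 / γ) by ring,
    Real.mul_rpow hlog (Real.rpow_nonneg hx.1.le _), ← Real.rpow_mul hx.1.le,
    one_div_mul_cancel hγ.ne', Real.rpow_one, mul_comm]

/-- If `Ψ → 0` and `Ψ' → 1` as `t ↓ 0` (with `Ψ'` the derivative of `Ψ` near `0⁺`), then
`Ψ(t)/t → 1`: the mean value theorem on `[s, t]` and `s ↓ 0` (the step "`∫₀ᵗ (1+o(1)) dt = t(1+o(1))`"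
of the printed proof of Lemma 4.3, without integrals). [cite: BauerschmidtBrydgesSlade2015LogCorr, Lemma 4.3 (proof)] -/
theorem tendsto_div_self_of_hasDerivAt_nhdsGT {Ψ Ψ' : ℝ → ℝ}
    (hderiv : ∀ᶠ t in 𝓝[>] (0:ℝ), HasDerivAt Ψ (Ψ' t) t)
    (hΨ' : Tendsto Ψ' (𝓝[>] 0) (𝓝 1)) (hΨ0 : Tendsto Ψ (𝓝[>] 0) (𝓝 0)) :
    Tendsto (fun t => Ψ t / t) (𝓝[>] 0) (𝓝 1) := by
  rw [Metric.tendsto_nhds]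
  intro ε hε
  have hev : ∀ᶠ s in 𝓝[>] (0:ℝ), HasDerivAt Ψ (Ψ' s) s ∧ dist (Ψ' s) 1 < ε / 2 :=
    hderiv.and ((Metric.tendsto_nhds.1 hΨ') (ε / 2) (half_pos hε))
  obtain ⟨t₀, ht₀, hsub⟩ := mem_nhdsGT_iff_exists_Ioo_subset.1 hev
  have key : ∀ t ∈ Ioo (0:ℝ) t₀, |Ψ t - t| ≤ ε / 2 * t := by
    intro t ht
    have hst : ∀ s ∈ Ioo (0:ℝ) t, |Ψ t - Ψ s - (t - s)| ≤ ε / 2 * (t - s) := by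
      intro s hs
      have hcont : ContinuousOn Ψ (Icc s t) := fun x hx =>
        (hsub ⟨hs.1.trans_le hx.1, hx.2.trans_lt ht.2⟩).1.continuousAt.continuousWithinAt
      have hd : ∀ x ∈ Ioo s t, HasDerivAt Ψ (Ψ' x) x := fun x hx =>
        (hsub ⟨hs.1.trans hx.1, hx.2.trans ht.2⟩).1
      obtain ⟨c, hc, hceq⟩ := exists_hasDerivAt_eq_slope Ψ Ψ' hs.2 hcont hd
      have hc' : dist (Ψ' c) 1 < ε / 2 := (hsub ⟨hs.1.trans hc.1, hc.2.trans ht.2⟩).2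
      rw [hceq, Real.dist_eq] at hc'
      have hts : 0 < t - s := sub_pos.2 hs.2
      have h1 : (Ψ t - Ψ s) / (t - s) - 1 = (Ψ t - Ψ s - (t - s)) / (t - s) := by
        field_simp
      rw [h1, abs_div, abs_of_pos hts, div_lt_iff₀ hts] at hc'
      exact hc'.le
    have hs_id : Tendsto (fun s : ℝ => s) (𝓝[>] 0) (𝓝 0) :=
      tendsto_nhdsWithin_of_tendsto_nhds tendsto_id
    have hlim : Tendsto (fun s => |Ψ t - Ψ s - (t - s)| - ε / 2 * (t - s)) (𝓝[>] 0)
        (𝓝 (|Ψ t - 0 - (t - 0)| - ε / 2 * (t - 0))) :=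
      (((tendsto_const_nhds.sub hΨ0).sub (tendsto_const_nhds.sub hs_id)).abs).sub
        (tendsto_const_nhds.mul (tendsto_const_nhds.sub hs_id))
    have hev' : ∀ᶠ s in 𝓝[>] (0:ℝ), |Ψ t - Ψ s - (t - s)| - ε / 2 * (t - s) ≤ 0 := by
      filter_upwards [Ioo_mem_nhdsGT ht.1] with s hs
      linarith [hst s hs]
    have := le_of_tendsto hlim hev'
    simp only [sub_zero] at this
    linarith
  filter_upwards [Ioo_mem_nhdsGT ht₀] with t ht
  rw [Real.dist_eq]
  have ht0 : 0 < t := ht.1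
  calc |Ψ t / t - 1| = |Ψ t - t| / t := by
        rw [div_sub_one ht0.ne', abs_div, abs_of_pos ht0]
    _ ≤ ε / 2 * t / t := by gcongr; exact key t ht
    _ = ε / 2 := by field_simp
    _ < ε := half_lt_self hε

/-- **Lemma 4.3** of Bauerschmidt–Brydges–Slade 2015 ("Let `δ > 0`. Suppose that
`u : [0,δ) → [0,∞)` is continuous, differentiable on `(0,δ)`, that `u(0) = 0` and `u(t) > 0` for
`t > 0`, and that `u'(t) = (-log u(t))^{-γ}(1 + o(1))` (as `t ↓ 0`). Then
`u(t) = t(-log t)^{-γ}(1 + o(1))` (as `t ↓ 0`)"), proved for every `γ > 0` (in print `γ = ¼`,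
the last display of §1.4). Hypotheses as used: `u → 0` as `t ↓ 0` (for `u(0) = 0` and continuity at `0`), `u > 0`
and `u' =` the derivative on `(0,δ)`, and `u'(-log u)^γ → 1`; conclusion `u(t)(-log t)^γ/t → 1`.
Proof as printed, with the integral `∫₀^{u(t)}(-log v)^γ dv` replaced by the primitive-free form
`d/dt[u(-log u)^γ] = u'(-log u)^γ(1 - γ/(-log u)) → 1`, hence `u(-log u)^γ ∼ t`
(`tendsto_div_self_of_hasDerivAt_nhdsGT`), and the inversion `-log t ∼ -log u` read off from
`log(u(-log u)^γ/t) → 0`. [cite: BauerschmidtBrydgesSlade2015LogCorr, Lemma 4.3] -/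
theorem BBS2015_lem43 {γ δ : ℝ} (hγ : 0 < γ) (hδ : 0 < δ) {u u' : ℝ → ℝ}
    (hderiv : ∀ t ∈ Ioo 0 δ, HasDerivAt u (u' t) t) (hpos : ∀ t ∈ Ioo 0 δ, 0 < u t)
    (hu0 : Tendsto u (𝓝[>] 0) (𝓝 0))
    (hasym : Tendsto (fun t => u' t * (-Real.log (u t)) ^ γ) (𝓝[>] 0) (𝓝 1)) :
    Tendsto (fun t => u t * (-Real.log t) ^ γ / t) (𝓝[>] 0) (𝓝 1) := by
  set L : ℝ → ℝ := fun t => -Real.log (u t) with hL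
  have hIoo : Ioo (0:ℝ) δ ∈ 𝓝[>] (0:ℝ) := Ioo_mem_nhdsGT hδ
  have hev_pos : ∀ᶠ t in 𝓝[>] (0:ℝ), 0 < u t := by
    filter_upwards [hIoo] with t ht using hpos t ht
  have hev_small : ∀ᶠ t in 𝓝[>] (0:ℝ), u t < Real.exp (-1) :=
    hu0.eventually (gt_mem_nhds (Real.exp_pos _))
  have hL_gt : ∀ᶠ t in 𝓝[>] (0:ℝ), 1 < L t := by
    filter_upwards [hev_pos, hev_small] with t h0 h1
    have : Real.log (u t) < -1 := (Real.log_lt_iff_lt_exp h0).2 h1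
    simp only [hL]; linarith
  have hu0' : Tendsto u (𝓝[>] 0) (𝓝[>] 0) :=
    tendsto_nhdsWithin_iff.2 ⟨hu0, hev_pos⟩
  have hL_top : Tendsto L (𝓝[>] 0) atTop :=
    tendsto_neg_atBot_atTop.comp (Real.tendsto_log_nhdsGT_zero.comp hu0')
  set Ψ : ℝ → ℝ := fun t => u t * L t ^ γ with hΨ
  set Ψ' : ℝ → ℝ := fun t => u' t * L t ^ γ * (1 - γ * (L t)⁻¹) with hΨ'
  have hΨderiv : ∀ᶠ t in 𝓝[>] (0:ℝ), HasDerivAt Ψ (Ψ' t) t := by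
    filter_upwards [hIoo, hL_gt] with t ht hLt
    have hu : u t ≠ 0 := (hpos t ht).ne'
    have hL0 : -Real.log (u t) ≠ 0 := by simp only [hL] at hLt; linarith
    have h1 : HasDerivAt (fun s => -Real.log (u s)) (-(u' t / u t)) t :=
      ((hderiv t ht).log hu).neg
    have h2 : HasDerivAt (fun s => (-Real.log (u s)) ^ γ)
        (-(u' t / u t) * γ * (-Real.log (u t)) ^ (γ - 1)) t :=
      h1.rpow_const (Or.inl hL0)
    have h3 := (hderiv t ht).mul h2
    refine h3.congr_deriv ?_
    simp only [hΨ', hL]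
    rw [Real.rpow_sub_one hL0]
    field_simp
    ring
  have hΨ'lim : Tendsto Ψ' (𝓝[>] 0) (𝓝 1) := by
    have h1 : Tendsto (fun t => 1 - γ * (L t)⁻¹) (𝓝[>] 0) (𝓝 (1 - γ * 0)) :=
      tendsto_const_nhds.sub (tendsto_const_nhds.mul hL_top.inv_tendsto_atTop)
    rw [mul_zero, sub_zero] at h1
    simpa [hΨ'] using hasym.mul h1
  have hΨ0 : Tendsto Ψ (𝓝[>] 0) (𝓝 0) :=
    (tendsto_mul_neg_log_rpow_nhdsGT_zero hγ).comp hu0'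
  have hA : Tendsto (fun t => Ψ t / t) (𝓝[>] 0) (𝓝 1) :=
    tendsto_div_self_of_hasDerivAt_nhdsGT hΨderiv hΨ'lim hΨ0
  have hident : ∀ᶠ t in 𝓝[>] (0:ℝ),
      (-Real.log t) / L t = Real.log (Ψ t / t) / L t + 1 - γ * (Real.log (L t) / L t) := by
    filter_upwards [hev_pos, hL_gt, self_mem_nhdsWithin] with t hut hLt ht
    have ht : 0 < t := ht
    have hLpos : 0 < L t := by linarith
    have hLγ : 0 < L t ^ γ := Real.rpow_pos_of_pos hLpos γ
    have hlogA : Real.log (Ψ t / t) = Real.log (u t) + γ * Real.log (L t) - Real.log t := by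
      simp only [hΨ]
      rw [Real.log_div (mul_pos hut hLγ).ne' ht.ne', Real.log_mul hut.ne' hLγ.ne',
        Real.log_rpow hLpos]
    rw [hlogA]
    have : Real.log (u t) = -L t := by simp [hL]
    rw [this]
    field_simp
    ring
  have hlogA0 : Tendsto (fun t => Real.log (Ψ t / t) / L t) (𝓝[>] 0) (𝓝 0) := by
    have h1 : Tendsto (fun t => Real.log (Ψ t / t)) (𝓝[>] 0) (𝓝 0) := by
      have h := (Real.continuousAt_log one_ne_zero).tendsto.comp hA
      simpa [Function.comp_def] using h
    exact h1.div_atTop hL_top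
  have hlogLL : Tendsto (fun t => Real.log (L t) / L t) (𝓝[>] 0) (𝓝 0) := by
    have h := (Real.tendsto_pow_log_div_mul_add_atTop 1 0 1 one_ne_zero).comp hL_top
    refine h.congr' ?_
    filter_upwards with t
    simp
  have hQ : Tendsto (fun t => (-Real.log t) / L t) (𝓝[>] 0) (𝓝 1) := by
    have h : Tendsto (fun t => Real.log (Ψ t / t) / L t + 1 - γ * (Real.log (L t) / L t))
        (𝓝[>] 0) (𝓝 (0 + 1 - γ * 0)) :=
      (hlogA0.add tendsto_const_nhds).sub (tendsto_const_nhds.mul hlogLL)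
    rw [zero_add, mul_zero, sub_zero] at h
    exact h.congr' (EventuallyEq.symm hident)
  have hQγ : Tendsto (fun t => ((-Real.log t) / L t) ^ γ) (𝓝[>] 0) (𝓝 1) := by
    have hc : ContinuousAt (fun x : ℝ => x ^ γ) 1 :=
      Real.continuousAt_rpow_const 1 γ (Or.inl one_ne_zero)
    have h := hc.tendsto.comp hQ
    simpa [Function.comp_def, Real.one_rpow] using h
  have hfinal : ∀ᶠ t in 𝓝[>] (0:ℝ),
      u t * (-Real.log t) ^ γ / t = (Ψ t / t) * ((-Real.log t) / L t) ^ γ := by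
    filter_upwards [hL_gt, Ioo_mem_nhdsGT (zero_lt_one' ℝ)] with t hLt ht
    have hLpos : 0 < L t := by linarith
    have hMnn : 0 ≤ -Real.log t := by
      rw [neg_nonneg]; exact Real.log_nonpos ht.1.le ht.2.le
    rw [Real.div_rpow hMnn hLpos.le]
    have hLγ : L t ^ γ ≠ 0 := (Real.rpow_pos_of_pos hLpos γ).ne'
    simp only [hΨ]
    field_simp
  have h := hA.mul hQγ
  rw [one_mul] at h
  exact h.congr' (EventuallyEq.symm hfinal)

/-! ### Theorem 1.1 from Theorem 4.1 (proved: §4.3 of the source) -/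

/-- Bookkeeping for (1.10): if `|x - 1| ≤ a ≤ ¼`, `|y - 1| ≤ e ≤ ¼` and `0 ≤ γ ≤ 1` then
`|x^γ/y - 1| ≤ 2(a + e)` (used with `x = g̃₀(0)/g`, `y = c₀(g)`, `γ = ¼`). [folklore] -/
theorem abs_rpow_div_sub_one_le {x y a e γ : ℝ} (hx : |x - 1| ≤ a) (hy : |y - 1| ≤ e)
    (ha : a ≤ 1 / 4) (he : e ≤ 1 / 4) (hγ0 : 0 ≤ γ) (hγ1 : γ ≤ 1) :
    |x ^ γ / y - 1| ≤ 2 * (a + e) := by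
  have hx' := abs_le.1 hx
  have hy' := abs_le.1 hy
  have ha0 : 0 ≤ a := (abs_nonneg _).trans hx
  have he0 : 0 ≤ e := (abs_nonneg _).trans hy
  have hx0 : 0 ≤ x := by linarith
  have hy0 : 0 < y := by linarith
  have hxγ : |x ^ γ - 1| ≤ a := by
    rcases le_total 1 x with h1x | hx1
    · have h1 : 1 ≤ x ^ γ := Real.one_le_rpow h1x hγ0
      have h2 : x ^ γ ≤ x := Real.rpow_le_self_of_one_le h1x hγ1
      rw [abs_of_nonneg (by linarith)]
      linarith
    · have h1 : x ≤ x ^ γ := Real.self_le_rpow_of_le_one hx0 hx1 hγ1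
      have h2 : x ^ γ ≤ 1 := Real.rpow_le_one hx0 hx1 hγ0
      rw [abs_of_nonpos (by linarith)]
      linarith
  have hdiff : |x ^ γ - y| ≤ a + e := by
    rw [show x ^ γ - y = (x ^ γ - 1) - (y - 1) by ring]
    exact (abs_sub _ _).trans (add_le_add hxγ hy)
  rw [div_sub_one hy0.ne', abs_div, abs_of_pos hy0, div_le_iff₀ hy0]
  nlinarith [mul_nonneg (add_nonneg ha0 he0) (by linarith : (0:ℝ) ≤ 2 * y - 1)]

/-- `(-log m + w)/(-log m) → 1` when `m → 0⁺` and `w` converges (the comparison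
`-log F(ν) ∼ -log m̃²` in the proof of Theorem 1.1, where `F ∼ (1 + z̃₀(0))⁻¹m̃²`). [folklore] -/
theorem tendsto_neg_log_add_div_neg_log {α : Type*} {l : Filter α} {m w : α → ℝ} {w₀ : ℝ}
    (hm : Tendsto m l (𝓝[>] 0)) (hw : Tendsto w l (𝓝 w₀)) :
    Tendsto (fun t => (-Real.log (m t) + w t) / (-Real.log (m t))) l (𝓝 1) := by
  have hM : Tendsto (fun t => -Real.log (m t)) l atTop :=
    tendsto_neg_atBot_atTop.comp (Real.tendsto_log_nhdsGT_zero.comp hm)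
  have h1 : Tendsto (fun t => 1 + w t / (-Real.log (m t))) l (𝓝 (1 + 0)) :=
    tendsto_const_nhds.add (hw.div_atTop hM)
  rw [add_zero] at h1
  refine h1.congr' ?_
  filter_upwards [hM.eventually_gt_atTop 0] with t ht
  have hne : Real.log (m t) ≠ 0 := by linarith
  field_simp
  ring

/-- **Theorem 1.1 from Theorem 4.1** — the source's §4.3 ("Proof of Theorem 1.1 assuming
Theorem 4.1"), PROVED: given Theorem 4.1 (`BBS2015_thm41`), Proposition 4.2(ii)
(`BBS2015_prop42ii`), the differentiability of `χ` in `ν` (Lemma 2.1, `BBS2015_lem21`) and the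
free-bubble asymptotics (1.8) (`BBS2015_eq18`), Theorem 1.1 (`BBS2015_thm11`) holds. The proof
is the printed one: with `ν = ν_c + ε` and `(m̃², g̃₀, ν̃₀, z̃₀)` from Proposition 4.2(ii),
`χ(g,ν) = (1 + z̃₀)χ̂ = (1 + z̃₀)/m̃²`, `∂χ/∂ν = (1 + z̃₀)²∂χ̂/∂ν₀ ∼ -χ² c₀(g)/(g̃₀𝖡_{m̃²})^γ`
with `c₀(g) = c(g̃₀(g,0))`; `F = 1/χ ∼ (1 + z̃₀(0))⁻¹m̃²`, `F' ∼ c₀(g)(g̃₀(0)𝖻)^{-γ}(-log F)^{-γ}`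
by (1.8); Lemma 4.3 with `u = (g̃₀(0)𝖻)^γ c₀(g)⁻¹ F(ν_c + ·)` gives
`χ(g, ν_c + ε) ∼ A_g ε⁻¹(log ε⁻¹)^γ`, `A_g = (g̃₀(0)𝖻)^γ/c₀(g)`, and
`A_g/(𝖻g)^γ = (g̃₀(0)/g)^γ/c₀(g) = 1 + O(g)` from `g̃₀ = g + O(g²)`, `c = 1 + O(g₀)` (explicit
constant `2|K₁| + 4|K|` for `0 < g < min(δ₁, 1/(4|K₁|+4), 1/(8|K|+8))`).
[cite: BauerschmidtBrydgesSlade2015LogCorr, §4.3 (Proof of Theorem 1.1)] -/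
theorem BBS2015_thm11_of_thm41 (h41 : BBS2015_thm41) (h42 : BBS2015_prop42ii)
    (h21 : BBS2015_lem21) (h18 : BBS2015_eq18) : BBS2015_thm11 := by
  obtain ⟨δ, K, ν₀c, z₀c, c, hD⟩ := h41
  obtain ⟨δ₁, K₁, hδ₁, htraj⟩ := h42 δ K ν₀c z₀c c hD
  have hb : 0 < freeBubbleB := by unfold freeBubbleB; positivity
  have hK₁4 : 0 < 4 * |K₁| + 4 := by positivity
  have hK8 : 0 < 8 * |K| + 8 := by positivity
  refine ⟨min δ₁ (min (1 / (4 * |K₁| + 4)) (1 / (8 * |K| + 8))), 2 * |K₁| + 4 * |K|,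
    lt_min hδ₁ (lt_min (by positivity) (by positivity)), fun g hg hglt => ?_⟩
  have hgδ₁ : g < δ₁ := hglt.trans_le (min_le_left _ _)
  have hg1 : g ≤ 1 / (4 * |K₁| + 4) :=
    (hglt.trans_le ((min_le_right _ _).trans (min_le_left _ _))).le
  have hg2 : g ≤ 1 / (8 * |K| + 8) :=
    (hglt.trans_le ((min_le_right _ _).trans (min_le_right _ _))).le
  have hgK₁ : |K₁| * g ≤ 1 / 4 := by
    rw [le_div_iff₀ hK₁4] at hg1
    nlinarith [abs_nonneg K₁]
  have hgK : 2 * |K| * g ≤ 1 / 4 := by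
    rw [le_div_iff₀ hK8] at hg2
    nlinarith [abs_nonneg K]
  have hK₁g : K₁ * g ≤ 1 / 4 := (mul_le_mul_of_nonneg_right (le_abs_self K₁) hg.le).trans hgK₁
  obtain ⟨ε₁, hε₁, mt, gt, hmt0, hmt_c, hgt_c, hmt_pos, hrel⟩ := htraj g ⟨hg, hgδ₁⟩
  -- the data at `ε = 0`: `ĝ₀ = g̃₀(g,0)`, `zh₀ = z̃₀(g,0) = z₀ᶜ(0, ĝ₀)`
  obtain ⟨-, hĝ₀, hĝ₀g, -, hz0, -, -⟩ := hrel 0 ⟨le_rfl, hε₁⟩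
  rw [hmt0] at hz0
  set ĝ₀ : ℝ := gt 0 with hĝ₀def
  set zh₀ : ℝ := z₀c 0 ĝ₀ with hzh₀def
  have hzh34 : 3 / 4 ≤ 1 + zh₀ := by
    have h1 := (abs_le.1 hz0).1
    simp only [hzh₀def]
    linarith
  have hx : |ĝ₀ / g - 1| ≤ |K₁| * g := by
    rw [div_sub_one hg.ne', abs_div, abs_of_pos hg, div_le_iff₀ hg]
    calc |ĝ₀ - g| ≤ K₁ * g ^ 2 := hĝ₀g
      _ ≤ |K₁| * g ^ 2 := by gcongr; exact le_abs_self K₁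
      _ = |K₁| * g * g := by ring
  have hĝ₀le : ĝ₀ ≤ 2 * g := by
    have h1 : ĝ₀ - g ≤ |K₁| * g ^ 2 :=
      (le_abs_self _).trans (hĝ₀g.trans (by gcongr; exact le_abs_self K₁))
    nlinarith
  have hy : |c ĝ₀ - 1| ≤ 2 * |K| * g := by
    calc |c ĝ₀ - 1| ≤ K * ĝ₀ := hD.c_sub_one ĝ₀ hĝ₀
      _ ≤ |K| * ĝ₀ := mul_le_mul_of_nonneg_right (le_abs_self K) hĝ₀.1.le
      _ ≤ |K| * (2 * g) := mul_le_mul_of_nonneg_left hĝ₀le (abs_nonneg K)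
      _ = 2 * |K| * g := by ring
  have hcpos : 0 < c ĝ₀ := by
    have h1 := (abs_le.1 (hy.trans hgK)).1
    linarith
  have hĝb : 0 < (ĝ₀ * freeBubbleB) ^ (1 / 4 : ℝ) := Real.rpow_pos_of_pos (mul_pos hĝ₀.1 hb) _
  set κ : ℝ := c ĝ₀ / (ĝ₀ * freeBubbleB) ^ (1 / 4 : ℝ) with hκ
  have hκpos : 0 < κ := div_pos hcpos hĝb
  refine ⟨κ⁻¹, inv_pos.2 hκpos, ?_, ?_⟩
  · -- (1.10): `A_g/(𝖻g)^γ = (ĝ₀/g)^γ/c(ĝ₀) = 1 + O(g)`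
    have h1 : (ĝ₀ * freeBubbleB) ^ (1 / 4 : ℝ) =
        (ĝ₀ / g) ^ (1 / 4 : ℝ) * (freeBubbleB * g) ^ (1 / 4 : ℝ) := by
      rw [← Real.mul_rpow (div_pos hĝ₀.1 hg).le (mul_pos hb hg).le]
      congr 1
      field_simp
    have hA : κ⁻¹ / (freeBubbleB * g) ^ (1 / 4 : ℝ) = (ĝ₀ / g) ^ (1 / 4 : ℝ) / c ĝ₀ := by
      have hbg : 0 < (freeBubbleB * g) ^ (1 / 4 : ℝ) := Real.rpow_pos_of_pos (mul_pos hb hg) _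
      rw [hκ, inv_div, h1]
      field_simp
    rw [hA]
    calc |(ĝ₀ / g) ^ (1 / 4 : ℝ) / c ĝ₀ - 1| ≤ 2 * (|K₁| * g + 2 * |K| * g) :=
          abs_rpow_div_sub_one_le hx hy hgK₁ hgK (by norm_num) (by norm_num)
      _ = (2 * |K₁| + 4 * |K|) * g := by ring
  · -- (1.9)
    set ν_c : ℝ := criticalNu 4 g with hν_c
    set X : ℝ → ℝ := fun t => (susceptibility 4 g (ν_c + t)).toReal with hX
    set X' : ℝ → ℝ := fun t => deriv (fun ν => (susceptibility 4 g ν).toReal) (ν_c + t) with hX'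
    -- pointwise consequences on `(0, ε₁)`: `χ = (1+z̃₀)/m̃²` and `∂χ̂/∂ν₀ = χ'/(1+z̃₀)²`
    have hP : ∀ t ∈ Ioo (0:ℝ) ε₁,
        0 < mt t ∧ mt t < δ ∧ gt t ∈ Ioo (0:ℝ) δ ∧ 3 / 4 ≤ 1 + z₀c (mt t) (gt t) ∧
        X t = (1 + z₀c (mt t) (gt t)) / mt t ∧
        HasDerivAt X (X' t) t ∧
        deriv (fun ν₀ => chiHat 4 (mt t) (gt t) ν₀ (z₀c (mt t) (gt t))) (ν₀c (mt t) (gt t)) =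
          X' t / (1 + z₀c (mt t) (gt t)) ^ 2 := by
      intro t ht
      obtain ⟨hmtδ, hgt, -, -, hzt, hgeq, hνeq⟩ := hrel t ⟨ht.1.le, ht.2⟩
      have hmt := hmt_pos t ht
      have hz34 : 3 / 4 ≤ 1 + z₀c (mt t) (gt t) := by
        have h1 := (abs_le.1 hzt).1
        linarith
      have hzne : 1 + z₀c (mt t) (gt t) ≠ 0 := by linarith
      have h433 : X t = (1 + z₀c (mt t) (gt t)) / mt t := by
        have h := hD.chiHat_eq (mt t) ⟨hmt, hmtδ⟩ (gt t) hgt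
        simp only [chiHat] at h
        rw [← hgeq, ← hνeq, div_eq_iff hzne] at h
        simp only [hX]
        rw [h]
        field_simp
      have h21t := (h21 4 (by norm_num) g hg (ν_c + t) (by linarith [ht.1])).2.hasDerivAt
      have hderX : HasDerivAt X (X' t) t := h21t.comp_const_add ν_c t
      have hinner : HasDerivAt (fun ν₀ : ℝ => (ν₀ + mt t) / (1 + z₀c (mt t) (gt t)))
          (1 / (1 + z₀c (mt t) (gt t))) (ν₀c (mt t) (gt t)) := by
        simpa using ((hasDerivAt_id (ν₀c (mt t) (gt t))).add_const (mt t)).div_const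
          (1 + z₀c (mt t) (gt t))
      have hcomp := (h21t.comp_of_eq _ hinner hνeq).div_const (1 + z₀c (mt t) (gt t))
      have hfun : (fun ν₀ => chiHat 4 (mt t) (gt t) ν₀ (z₀c (mt t) (gt t))) =
          fun x => ((fun ν' => (susceptibility 4 g ν').toReal) ∘
            fun ν₀ => (ν₀ + mt t) / (1 + z₀c (mt t) (gt t))) x / (1 + z₀c (mt t) (gt t)) := by
        funext ν₀
        simp only [chiHat, Function.comp_apply]
        rw [← hgeq]
      have hslice : HasDerivAt (fun ν₀ => chiHat 4 (mt t) (gt t) ν₀ (z₀c (mt t) (gt t)))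
          (X' t * (1 / (1 + z₀c (mt t) (gt t))) / (1 + z₀c (mt t) (gt t)))
          (ν₀c (mt t) (gt t)) := by
        rw [hfun]
        exact hcomp
      refine ⟨hmt, hmtδ, hgt, hz34, h433, hderX, ?_⟩
      rw [hslice.deriv]
      field_simp
    have hXpos : ∀ t ∈ Ioo (0:ℝ) ε₁, 0 < X t := fun t ht => by
      obtain ⟨hmt, -, -, hz34, h433, -⟩ := hP t ht
      rw [h433]
      exact div_pos (by linarith) hmt
    -- limits along the trajectory
    have hIoo : Ioo (0:ℝ) ε₁ ∈ 𝓝[>] (0:ℝ) := Ioo_mem_nhdsGT hε₁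
    have hmt_t : Tendsto mt (𝓝[>] 0) (𝓝 0) := by
      have h := hmt_c.tendsto
      rw [hmt0] at h
      exact h.mono_left (nhdsWithin_mono _ Ioi_subset_Ici_self)
    have hgt_t : Tendsto gt (𝓝[>] 0) (𝓝 ĝ₀) :=
      hgt_c.tendsto.mono_left (nhdsWithin_mono _ Ioi_subset_Ici_self)
    have hmt_t' : Tendsto mt (𝓝[>] 0) (𝓝[>] 0) :=
      tendsto_nhdsWithin_iff.2 ⟨hmt_t, by
        filter_upwards [hIoo] with t ht using (hP t ht).1⟩
    have hpair : Tendsto (fun t => (mt t, gt t)) (𝓝[>] 0) (𝓝[Ioo 0 δ ×ˢ Ioo 0 δ] (0, ĝ₀)) :=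
      tendsto_nhdsWithin_iff.2 ⟨hmt_t.prodMk_nhds hgt_t, by
        filter_upwards [hIoo] with t ht
        exact ⟨⟨(hP t ht).1, (hP t ht).2.1⟩, (hP t ht).2.2.1⟩⟩
    have hz_t : Tendsto (fun t => z₀c (mt t) (gt t)) (𝓝[>] 0) (𝓝 zh₀) := by
      have hcont := hD.cont_z₀c (0, ĝ₀) ⟨⟨le_rfl, hD.pos⟩, hĝ₀.1.le, hĝ₀.2⟩
      have hpair' : Tendsto (fun t => (mt t, gt t)) (𝓝[>] 0)
          (𝓝[Ico 0 δ ×ˢ Ico 0 δ] (0, ĝ₀)) :=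
        hpair.mono_right
          (nhdsWithin_mono _ (Set.prod_mono Ioo_subset_Ico_self Ioo_subset_Ico_self))
      have h := hcont.tendsto.comp hpair'
      simpa [Function.comp_def] using h
    -- Theorem 4.1 (second display) along the trajectory, and (1.8) along `m̃²`
    have h414 := (hD.chiHat_deriv ĝ₀ hĝ₀).comp hpair
    have hBratio : Tendsto (fun t => freeBubble 4 (mt t) / (freeBubbleB * Real.log (mt t)⁻¹))
        (𝓝[>] 0) (𝓝 1) := h18.comp hmt_t'
    have hlogtop : Tendsto (fun t => Real.log (mt t)⁻¹) (𝓝[>] 0) atTop :=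
      Real.tendsto_log_atTop.comp (tendsto_inv_nhdsGT_zero.comp hmt_t')
    have hBpos : ∀ᶠ t in 𝓝[>] (0:ℝ), 0 < freeBubble 4 (mt t) := by
      filter_upwards [hBratio.eventually (lt_mem_nhds one_half_lt_one),
        hlogtop.eventually_gt_atTop 0] with t h1 h2
      have hden : 0 < freeBubbleB * Real.log (mt t)⁻¹ := mul_pos hb h2
      have h3 := (lt_div_iff₀ hden).1 h1
      linarith [mul_pos one_half_pos hden]
    -- `F = 1/χ`, `F' = -χ'/χ²`: `F'(ν)(ĝ₀𝖡_{m̃²})^γ/c(ĝ₀) → 1`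
    have hF' : Tendsto (fun t => (-X' t / X t ^ 2) * (ĝ₀ * freeBubble 4 (mt t)) ^ (1 / 4 : ℝ) /
        c ĝ₀) (𝓝[>] 0) (𝓝 1) := by
      refine h414.congr' ?_
      filter_upwards [hIoo, hBpos] with t ht hB
      obtain ⟨hmt, -, -, hz34, h433, -, hdS⟩ := hP t ht
      have hzne : 1 + z₀c (mt t) (gt t) ≠ 0 := by linarith
      have hBγ : (ĝ₀ * freeBubble 4 (mt t)) ^ (1 / 4 : ℝ) ≠ 0 :=
        (Real.rpow_pos_of_pos (mul_pos hĝ₀.1 hB) _).ne'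
      simp only [Function.comp_apply]
      rw [hdS, h433]
      field_simp
    -- `u = F/κ` and Lemma 4.3
    set u : ℝ → ℝ := fun t => (X t)⁻¹ / κ with hu
    set u' : ℝ → ℝ := fun t => (-X' t / X t ^ 2) / κ with hu'
    have hu_pos : ∀ t ∈ Ioo (0:ℝ) ε₁, 0 < u t := fun t ht =>
      div_pos (inv_pos.2 (hXpos t ht)) hκpos
    have hu_deriv : ∀ t ∈ Ioo (0:ℝ) ε₁, HasDerivAt u (u' t) t := fun t ht => by
      obtain ⟨-, -, -, -, -, hderX, -⟩ := hP t ht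
      have h := (hderX.inv (hXpos t ht).ne').div_const κ
      simpa [hu, hu'] using h
    have hu0 : Tendsto u (𝓝[>] 0) (𝓝 0) := by
      have h1 : Tendsto (fun t => mt t / (1 + z₀c (mt t) (gt t)) / κ) (𝓝[>] 0)
          (𝓝 (0 / (1 + zh₀) / κ)) :=
        (hmt_t.div (tendsto_const_nhds.add hz_t) (by linarith)).div_const κ
      rw [zero_div, zero_div] at h1
      refine h1.congr' ?_
      filter_upwards [hIoo] with t ht
      obtain ⟨hmt, -, -, hz34, h433, -⟩ := hP t ht
      simp only [hu]
      rw [h433, inv_div]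
    have hw : Tendsto (fun t => Real.log (1 + z₀c (mt t) (gt t)) + Real.log κ) (𝓝[>] 0)
        (𝓝 (Real.log (1 + zh₀) + Real.log κ)) := by
      have h1 : Tendsto (fun t => 1 + z₀c (mt t) (gt t)) (𝓝[>] 0) (𝓝 (1 + zh₀)) :=
        tendsto_const_nhds.add hz_t
      exact ((Real.continuousAt_log (by linarith)).tendsto.comp h1).add tendsto_const_nhds
    have hW := tendsto_neg_log_add_div_neg_log hmt_t' hw
    have hneglog : Tendsto (fun t => -Real.log (mt t)) (𝓝[>] 0) atTop :=
      tendsto_neg_atBot_atTop.comp (Real.tendsto_log_nhdsGT_zero.comp hmt_t')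
    have hWtop : Tendsto (fun t => -Real.log (mt t) + (Real.log (1 + z₀c (mt t) (gt t)) +
        Real.log κ)) (𝓝[>] 0) atTop := hneglog.atTop_add hw
    have hbB : Tendsto (fun t => freeBubbleB * (-Real.log (mt t)) / freeBubble 4 (mt t))
        (𝓝[>] 0) (𝓝 1) := by
      have h := hBratio.inv₀ one_ne_zero
      rw [inv_one] at h
      refine h.congr' ?_
      filter_upwards with t
      rw [inv_div, Real.log_inv]
    have hratio : Tendsto (fun t => (freeBubbleB * (-Real.log (mt t) +
        (Real.log (1 + z₀c (mt t) (gt t)) + Real.log κ)) / freeBubble 4 (mt t)) ^ (1 / 4 : ℝ))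
        (𝓝[>] 0) (𝓝 1) := by
      have h1 := hbB.mul hW
      rw [one_mul] at h1
      have h2 : Tendsto (fun t => freeBubbleB * (-Real.log (mt t) +
          (Real.log (1 + z₀c (mt t) (gt t)) + Real.log κ)) / freeBubble 4 (mt t))
          (𝓝[>] 0) (𝓝 1) := by
        refine h1.congr' ?_
        filter_upwards [hneglog.eventually_gt_atTop 0, hBpos] with t hl hB
        have hne : Real.log (mt t) ≠ 0 := by linarith
        field_simp
      have hc := (Real.continuousAt_rpow_const 1 (1 / 4 : ℝ) (Or.inl one_ne_zero)).tendsto.comp h2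
      simpa [Function.comp_def, Real.one_rpow] using hc
    have hasym : Tendsto (fun t => u' t * (-Real.log (u t)) ^ (1 / 4 : ℝ)) (𝓝[>] 0) (𝓝 1) := by
      have hprod := hF'.mul hratio
      rw [one_mul] at hprod
      refine hprod.congr' ?_
      filter_upwards [hIoo, hBpos, hWtop.eventually_ge_atTop 0] with t ht hB hWp
      obtain ⟨hmt, -, -, hz34, h433, -⟩ := hP t ht
      have hz : 0 < 1 + z₀c (mt t) (gt t) := by linarith
      have hlogu : -Real.log (u t) =
          -Real.log (mt t) + (Real.log (1 + z₀c (mt t) (gt t)) + Real.log κ) := by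
        simp only [hu]
        rw [h433, inv_div, Real.log_div (div_pos hmt hz).ne' hκpos.ne',
          Real.log_div hmt.ne' hz.ne']
        ring
      rw [hlogu, Real.div_rpow (mul_nonneg hb.le hWp) hB.le, Real.mul_rpow hb.le hWp,
        Real.mul_rpow hĝ₀.1.le hB.le]
      have hBγ : freeBubble 4 (mt t) ^ (1 / 4 : ℝ) ≠ 0 := (Real.rpow_pos_of_pos hB _).ne'
      have hbγ : freeBubbleB ^ (1 / 4 : ℝ) ≠ 0 := (Real.rpow_pos_of_pos hb _).ne'
      have hgγ : ĝ₀ ^ (1 / 4 : ℝ) ≠ 0 := (Real.rpow_pos_of_pos hĝ₀.1 _).ne'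
      simp only [hu', hκ]
      rw [Real.mul_rpow hĝ₀.1.le hb.le]
      field_simp
    have hconc := BBS2015_lem43 (γ := 1 / 4) (by norm_num) hε₁ hu_deriv hu_pos hu0 hasym
    have hfin := hconc.inv₀ one_ne_zero
    rw [inv_one] at hfin
    refine hfin.congr' ?_
    filter_upwards [hIoo, Ioo_mem_nhdsGT (zero_lt_one' ℝ)] with t ht ht1
    have hXt := hXpos t ht
    have hlog : 0 < (-Real.log t) ^ (1 / 4 : ℝ) :=
      Real.rpow_pos_of_pos (by rw [neg_pos]; exact Real.log_neg ht1.1 ht1.2) _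
    simp only [hu, hX] at hXt ⊢
    rw [Real.log_inv]
    field_simp

end CTWSAW

/-- The barrier `WeaklySAWFourDimLogCorrections` (= Theorem 1.1) from Theorem 4.1, Proposition
4.2(ii), Lemma 2.1 and (1.8) of the source. [cite: BauerschmidtBrydgesSlade2015LogCorr, Theorem 1.1 and §4.3] -/
theorem weaklySAWFourDimLogCorrections_of_thm41 (h41 : CTWSAW.BBS2015_thm41)
    (h42 : CTWSAW.BBS2015_prop42ii) (h21 : CTWSAW.BBS2015_lem21) (h18 : CTWSAW.BBS2015_eq18) :
    WeaklySAWFourDimLogCorrections :=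
  CTWSAW.BBS2015_thm11_of_thm41 h41 h42 h21 h18

end Literature.Barriers.CriticalPhenomena
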